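import Mathlib.NumberTheory.Padics.PadicNumbers
import Mathlib.Topology.Algebra.InfiniteSum.Basic
import Literature.NumberTheory.EllipticCurves.Sprung2017.HalfLogarithmMatrix
import HarnessLib

/-!
# Sprung 2017, §3.1 (Lemma 3.3 / Thm. 1.1): the α-free half-logarithm matrix `ℒ(3, ±3)` as a
# coefficientwise `3`-adic LIMIT — definition, convergence with an explicit rate, and `ℒ(0) = C^{−2}`

Topic `NumberTheory/EllipticCurves`, cluster `Sprung2017`. ONE definition with body (`halfLogMatrix`) +
proofs; no named fact, no instance. Sequel of `HalfLogarithmMatrix.lean` (the exact approximants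
`A_n = 𝒞_1⋯𝒞_n C^{−(n+2)}` over `ℚ[T]`, the increment identity and the `3`-adic numerator/denominator
estimates). Source: F. Sprung, ANT 11 (2017) [Sprung2017], §1 / §3.1 ("we construct a matrix
`Log_{α,β}(1+T)` whose entries are functions converging on the open unit disc in the supersingular case";
Def. 3.1, Lemma 3.3 (convergence)); Thm. 1.1 `(L_α, L_β) = (L♯, L♭)·Log_{α,β}`.

## What is here
* §1 generic: ultrametric telescoping in `ℚ_p` (`norm_sub_le_of_antitone`), Cauchy ⟹ limit with the same
  tail bound (`norm_limUnder_sub_le`);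
* §2 `coeffSeq b n i k j := ` the `j`-th coefficient of `(A_n)_{ik}` at `(p, a) = (3, 3b)`, read in `ℚ_3`,
  and **`norm_coeffSeq_succ_sub_le`**: `‖increment‖₃ ≤ 3^{⌊log₃ j⌋ + 2 − ⌊n/2⌋}` (numerator divisible by
  `3^{n − ⌊log₃ j⌋}`, denominator `3^{⌈(n+3)/2⌉}`: `HalfLogarithmMatrix.lean` §5–§6);
* §3 **`halfLogMatrix b : Matrix (Fin 2) (Fin 2) ℚ_3⟦T⟧`** — `ℒ(3, 3b)`, entry `(i,k)`, coefficient `j` :=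
  `lim_n coeff_j (A_n)_{ik}`; `tendsto_coeffSeq` (it IS the limit), `norm_coeff_halfLogMatrix_sub_le` (tail
  bound);
* §4 `coeff_zero_halfLogMatrix`: `ℒ(0) = C^{−2}`.
The derivative `ℒ′(0)` (closed form at `b = ±1` via `C⁶ = −27`) and the row-twist non-vanishing are in
`HalfLogarithmMatrixDerivativeProofs.lean`. HONEST FRAMING: elementary `3`-adic analysis of explicit
rational sequences; nothing about any curve; BSD is not proved by any of this. Consumer: stub S0 (both
colours non-zero on class X8) of the crux line `chromatic-common-zeros` (stmt-BirchSwinnertonDyer-19875).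
-/

noncomputable section

open Filter Topology Polynomial

namespace Literature.NumberTheory.EllipticCurves.Sprung2017

/-! ## §1 Ultrametric telescoping and limits in `ℚ_p` -/

section Ultrametric

variable {p : ℕ} [Fact p.Prime]

/-- Ultrametric telescoping: if `‖s_{n+1} − s_n‖ ≤ g(n)` with `g` antitone, then `‖s_m − s_n‖ ≤ g(n)` for
all `m ≥ n` (private plumbing). [folklore] -/
private theorem norm_sub_le_of_antitone {s : ℕ → ℚ_[p]} {g : ℕ → ℝ} (hg : Antitone g)
    (hs : ∀ n, ‖s (n + 1) - s n‖ ≤ g n) {n m : ℕ} (hnm : n ≤ m) : ‖s m - s n‖ ≤ g n := by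
  induction m, hnm using Nat.le_induction with
  | base => simpa using (norm_nonneg _).trans (hs n)
  | succ m hnm ih =>
    calc ‖s (m + 1) - s n‖ = ‖(s (m + 1) - s m) + (s m - s n)‖ := by rw [sub_add_sub_cancel]
      _ ≤ max ‖s (m + 1) - s m‖ ‖s m - s n‖ := Padic.nonarchimedean _ _
      _ ≤ max (g m) (g n) := max_le_max (hs m) ih
      _ = g n := max_eq_right (hg hnm)

/-- Under the same hypotheses with `g → 0`, the sequence is Cauchy. [folklore] -/
private theorem cauchySeq_of_antitone {s : ℕ → ℚ_[p]} {g : ℕ → ℝ} (hg : Antitone g)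
    (hg0 : Tendsto g atTop (𝓝 0)) (hs : ∀ n, ‖s (n + 1) - s n‖ ≤ g n) : CauchySeq s := by
  refine Metric.cauchySeq_iff'.mpr fun ε hε => ?_
  obtain ⟨N, hN⟩ := (hg0.eventually (gt_mem_nhds hε)).exists
  exact ⟨N, fun n hn => by rw [dist_eq_norm]; exact (norm_sub_le_of_antitone hg hs hn).trans_lt hN⟩

/-- … hence it converges to `limUnder atTop s`, with the SAME tail bound `‖lim − s_n‖ ≤ g(n)`. [folklore] -/
private theorem norm_limUnder_sub_le {s : ℕ → ℚ_[p]} {g : ℕ → ℝ} (hg : Antitone g)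
    (hg0 : Tendsto g atTop (𝓝 0)) (hs : ∀ n, ‖s (n + 1) - s n‖ ≤ g n) (n : ℕ) :
    ‖limUnder atTop s - s n‖ ≤ g n := by
  have hlim : Tendsto s atTop (𝓝 (limUnder atTop s)) := (cauchySeq_of_antitone hg hg0 hs).tendsto_limUnder
  have hcont : Tendsto (fun m => ‖s m - s n‖) atTop (𝓝 ‖limUnder atTop s - s n‖) :=
    ((continuous_norm.tendsto _).comp (hlim.sub tendsto_const_nhds))
  exact le_of_tendsto hcont (eventually_atTop.mpr ⟨n, fun m hm => norm_sub_le_of_antitone hg hs hm⟩)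

end Ultrametric

/-! ## §2 The coefficient sequences of the approximants at `(p, a) = (3, 3b)`, read in `ℚ_3` -/

/-- The `j`-th coefficient of the `(i,k)` entry of `A_n = 𝒞_1⋯𝒞_n C^{−(n+2)}` at `(p, a) = (3, 3b)`, as an
element of `ℚ_3`. [cite: Sprung2017, §3.1 (the partial products)] -/
def coeffSeq (b : ℤ) (n : ℕ) (i k : Fin 2) (j : ℕ) : ℚ_[3] :=
  (((halfLogApprox 3 (3 * b) n i k).coeff j : ℚ) : ℚ_[3])

/-- The tail bound `3^{⌊log₃ j⌋ + 2} / 3^{⌊n/2⌋}` (antitone in `n`, tends to `0`). [folklore] -/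
def tailBound (j n : ℕ) : ℝ := (3 : ℝ) ^ (Nat.log 3 j + 2) / (3 : ℝ) ^ (n / 2)

/-- `tailBound j` is antitone in `n`. [folklore] -/
private theorem tailBound_antitone (j : ℕ) : Antitone (tailBound j) := fun n m hnm =>
  div_le_div_of_nonneg_left (by positivity) (by positivity)
    (pow_le_pow_right₀ (by norm_num) (Nat.div_le_div_right hnm))

/-- `tailBound j n → 0`. [folklore] -/
private theorem tendsto_tailBound (j : ℕ) : Tendsto (tailBound j) atTop (𝓝 0) := by
  have hdiv : Tendsto (fun n : ℕ => n / 2) atTop atTop :=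
    tendsto_atTop_atTop.mpr fun b => ⟨2 * b, fun n hn => by omega⟩
  exact tendsto_const_nhds.div_atTop ((tendsto_pow_atTop_atTop_of_one_lt (by norm_num)).comp hdiv)

/-- **The `3`-adic Cauchy estimate**: `‖coeff_j (A_{n+1} − A_n)_{ik}‖₃ ≤ 3^{⌊log₃ j⌋ + 2 − ⌊n/2⌋}`. The
increment is `−(Φ_{3^{n+1}}(1+T) − 3)·x_n·(C^{−(n+3)})_{0k}` (`halfLogApprox_succ_sub`); the `j`-th
coefficient of `(Φ_{3^{n+1}}(1+T) − 3)·x_n` is an integer divisible by `3^{n − ⌊log₃ j⌋}` (Kummer,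
`pow_dvd_coeff_cycloDelta_mul`) and `3^{⌈(n+3)/2⌉}(C^{−(n+3)})_{0k} ∈ ℤ` (`three_pow_smul_sprungCinv_pow`).
[cite: Sprung2017, §3.1 Lemma 3.3 (convergence of the partial products)] -/
theorem norm_coeffSeq_succ_sub_le (b : ℤ) (n : ℕ) (i k : Fin 2) (j : ℕ) :
    ‖coeffSeq b (n + 1) i k j - coeffSeq b n i k j‖ ≤ tailBound j n := by
  -- the increment, coefficient `j`
  have hinc := congrArg (fun q : ℚ[X] => q.coeff j) (halfLogApprox_succ_sub 3 (3 * b) n i k)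
  simp only [coeff_sub, coeff_mul_C, coeff_neg, ← Polynomial.map_mul, Polynomial.coeff_map,
    eq_intCast] at hinc
  -- numerator: `3^{n − L} ∣ z`
  obtain ⟨z, hz⟩ := pow_dvd_coeff_cycloDelta_mul n j (rowSeq (3 * b) 3 i n) j le_rfl
  -- denominator: `3^{⌈(n+3)/2⌉} · (C^{−(n+3)})_{0k} = J_{0k} ∈ ℤ`
  have hden := congrArg (fun M : Matrix (Fin 2) (Fin 2) ℚ => M 0 k) (three_pow_smul_sprungCinv_pow b (n + 3))
  simp only [Matrix.smul_apply, smul_eq_mul, RingHom.mapMatrix_apply, Matrix.map_apply, eq_intCast] at hden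
  set c : ℚ := (sprungCinv 3 (3 * b) ^ (n + 3)) 0 k with hc
  set J : ℤ := cinvNum b (n + 3) 0 k with hJ
  have h3 : (3 : ℚ) ^ ((n + 3 + 1) / 2) ≠ 0 := pow_ne_zero _ (by norm_num)
  have hc' : c = (J : ℚ) / (3 : ℚ) ^ ((n + 3 + 1) / 2) := by
    rw [eq_div_iff h3, mul_comm, hden]
  -- assemble the exact form of the increment
  have hform : coeffSeq b (n + 1) i k j - coeffSeq b n i k j =
      -(((z : ℚ_[3]) * (J : ℚ_[3])) * ((3 : ℚ_[3]) ^ (n - Nat.log 3 j) / (3 : ℚ_[3]) ^ ((n + 3 + 1) / 2))) := by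
    simp only [coeffSeq, ← Rat.cast_sub, hinc, hz, hc']
    push_cast
    ring
  have h3norm : ‖(3 : ℚ_[3])‖ = (3 : ℝ)⁻¹ := by simpa using Padic.norm_p (p := 3)
  rw [hform, norm_neg, norm_mul, norm_mul, norm_div, norm_pow, norm_pow, h3norm, inv_pow, inv_pow,
    inv_div_inv]
  -- `‖z‖, ‖J‖ ≤ 1`
  have hz1 : ‖(z : ℚ_[3])‖ ≤ 1 := Padic.norm_int_le_one z
  have hJ1 : ‖(J : ℚ_[3])‖ ≤ 1 := Padic.norm_int_le_one J
  have hzJ : ‖(z : ℚ_[3])‖ * ‖(J : ℚ_[3])‖ ≤ 1 := by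
    calc ‖(z : ℚ_[3])‖ * ‖(J : ℚ_[3])‖ ≤ 1 * 1 := mul_le_mul hz1 hJ1 (norm_nonneg _) zero_le_one
      _ = 1 := one_mul 1
  have key : (3 : ℝ) ^ ((n + 3 + 1) / 2) / (3 : ℝ) ^ (n - Nat.log 3 j) ≤ tailBound j n := by
    unfold tailBound
    rw [div_le_div_iff₀ (by positivity) (by positivity), ← pow_add, ← pow_add]
    exact pow_le_pow_right₀ (by norm_num) (by omega)
  have hpos : (0 : ℝ) ≤ (3 : ℝ) ^ ((n + 3 + 1) / 2) / (3 : ℝ) ^ (n - Nat.log 3 j) := by positivity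
  calc ‖(z : ℚ_[3])‖ * ‖(J : ℚ_[3])‖ * ((3 : ℝ) ^ ((n + 3 + 1) / 2) / (3 : ℝ) ^ (n - Nat.log 3 j))
      ≤ 1 * ((3 : ℝ) ^ ((n + 3 + 1) / 2) / (3 : ℝ) ^ (n - Nat.log 3 j)) :=
        mul_le_mul_of_nonneg_right hzJ hpos
    _ ≤ tailBound j n := by rw [one_mul]; exact key

/-! ## §3 The limit: the α-free half-logarithm matrix `ℒ(3, 3b)` -/

/-- **The α-free half-logarithm matrix `ℒ(3, 3b) = lim_n 𝒞_1⋯𝒞_n C^{−(n+2)} ∈ M₂(ℚ_3⟦T⟧)`** at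
`(p, a_p) = (3, 3b)`, entry `(i, k)`, coefficient `j` := the `3`-adic limit of `coeff_j (A_n)_{ik}` (which
exists: `tendsto_coeffSeq`). Sprung's `Log_{α,β}(1+T) = ℒ·(−1 −1; β α)` (§1); the first/second ROW of
`ℒ` are the α-free `♯`/`♭` half-logarithms. [cite: Sprung2017, §1 and §3.1 Def. 3.1 / Lemma 3.3 (Log_{α,β} := lim 𝒞_1⋯𝒞_n C^{−(n+2)} (−1 −1; β α))] -/
def halfLogMatrix (b : ℤ) : Matrix (Fin 2) (Fin 2) (PowerSeries ℚ_[3]) := fun i k =>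
  PowerSeries.mk fun j => limUnder atTop fun n => coeffSeq b n i k j

/-- The coefficients of `ℒ` ARE the limits of the coefficients of the approximants.
[cite: Sprung2017, §3.1 Lemma 3.3 (convergence)] -/
theorem tendsto_coeffSeq (b : ℤ) (i k : Fin 2) (j : ℕ) :
    Tendsto (fun n => coeffSeq b n i k j) atTop (𝓝 (PowerSeries.coeff j (halfLogMatrix b i k))) := by
  rw [halfLogMatrix, PowerSeries.coeff_mk]
  exact (cauchySeq_of_antitone (tailBound_antitone j) (tendsto_tailBound j)
    (fun n => norm_coeffSeq_succ_sub_le b n i k j)).tendsto_limUnder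

/-- **Tail bound**: `‖coeff_j ℒ_{ik} − coeff_j (A_n)_{ik}‖₃ ≤ 3^{⌊log₃ j⌋ + 2 − ⌊n/2⌋}`.
[cite: Sprung2017, §3.1 Lemma 3.3 (convergence)] -/
theorem norm_coeff_halfLogMatrix_sub_le (b : ℤ) (i k : Fin 2) (j n : ℕ) :
    ‖PowerSeries.coeff j (halfLogMatrix b i k) - coeffSeq b n i k j‖ ≤ tailBound j n := by
  rw [halfLogMatrix, PowerSeries.coeff_mk]
  exact norm_limUnder_sub_le (tailBound_antitone j) (tendsto_tailBound j)
    (fun n => norm_coeffSeq_succ_sub_le b n i k j) n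

/-- A constant coefficient sequence gives that constant as the coefficient of `ℒ`. [folklore] -/
private theorem coeff_halfLogMatrix_eq_of_forall {b : ℤ} {i k : Fin 2} {j : ℕ} {x : ℚ_[3]}
    (h : ∀ n, coeffSeq b n i k j = x) : PowerSeries.coeff j (halfLogMatrix b i k) = x :=
  tendsto_nhds_unique (tendsto_coeffSeq b i k j) (by simp_rw [h]; exact tendsto_const_nhds)

/-! ## §4 `ℒ(0) = C^{−2}` -/

/-- **`ℒ(0) = C^{−2}`**: every approximant has constant term `C^{−2}` (`coeff_zero_halfLogApprox`).
[cite: Sprung2017, §3.1 (𝒞_i(ζ_{p^0}) = C, so Log(0) is a finite product)] -/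
theorem coeff_zero_halfLogMatrix (b : ℤ) (i k : Fin 2) :
    PowerSeries.coeff 0 (halfLogMatrix b i k) = (((sprungCinv 3 (3 * b) ^ 2) i k : ℚ) : ℚ_[3]) :=
  coeff_halfLogMatrix_eq_of_forall fun n => by rw [coeffSeq, coeff_zero_halfLogApprox]

/-- Constant-term form: `constantCoeff ℒ_{ik} = (C^{−2})_{ik}`. [cite: Sprung2017, §3.1] -/
theorem constantCoeff_halfLogMatrix (b : ℤ) (i k : Fin 2) :
    PowerSeries.constantCoeff (halfLogMatrix b i k) = (((sprungCinv 3 (3 * b) ^ 2) i k : ℚ) : ℚ_[3]) := by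
  rw [← PowerSeries.coeff_zero_eq_constantCoeff_apply, coeff_zero_halfLogMatrix]

end Literature.NumberTheory.EllipticCurves.Sprung2017

end
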